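import Mathlib.Computability.TuringMachine.Computable
import Mathlib.Data.Finite.Prod
import Mathlib.Data.Finite.Sigma
import Mathlib.Data.Fintype.Option
import Mathlib.Data.Fintype.Sum
import Mathlib.Data.Fintype.Prod
import Mathlib.Data.Set.Finite.Basic
import Mathlib.SetTheory.Cardinal.NatCard
import Mathlib.Tactic.Linarith
import Mathlib.Tactic.Positivity
import Mathlib.Tactic.Ring
import Literature.Computability.Complexity.LocalMaps
import Literature.Computability.Complexity.TM2Window
import HarnessLib

/-!
# Simulation of Mathlib's multi-stack machines `FinTM2` by circuits (trunk CplxCore)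

The technical core of `P ⊆ P/poly` (Arora–Barak 2009, Thm. 6.6) for the machine model
underlying the H21 complexity classes, Mathlib's bundled multi-stack machines `Turing.FinTM2`
(`Turing.TM2.step`): `T` steps of a machine on inputs of length `n` are computed by a
`B₂`-straight-line program of size `O(S · T)`, where `S = n + D · T` bounds the stack heights.

We follow the direct (non-oblivious) tableau construction (Sipser 2012, proof of Thm. 9.30;
Arora–Barak 2009, proof of Thm. 6.6 with the oblivious simulation replaced by a full layer per
step), on top of the machine-side toolkit `TM2Window.lean` (`namespace Literature.CplxCore.TM2Sim`:
the total step function `TM2Sim.stepTotal`, the stack-operation depth `TM2Sim.depth`, the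
effective finite alphabets `TM2Sim.IsSym`/`TM2Sim.finite_isSym` with the invariant
`TM2Sim.Good`, halting runs as exact iterates `TM2Sim.iterate_stepTotal_of_bind`, and the
height bound `TM2Sim.length_iterate_stepTotal_le`) and of `TimeBoundsProofs.lean`
(`TM2Comp.initList_eq`, `TM2Comp.haltList_eq`). This file adds the circuit side:

* **Padded configurations** (`PCfg tm S`): the control `(label, internal state)` together with
  `S` *cells*; cell `i` records, for every stack `k`, the symbol at depth `i` below the top of
  stack `k` (`none` if the stack is shorter), symbols being restricted to the finite effective
  alphabet `StackSym tm k = {γ // TM2Sim.IsSym tm k γ}` (`FinTM2` only requires the *input*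
  alphabet to be finite).
* **The padded step** `pStep` is defined by the same recursion on statements as
  `Turing.TM2.stepAux` (`pStepAux`), with push/pop realised as shifts of the cell array. It is
  *cell-local* (`CellLocal`): the new control depends on the control and boundedly many cells,
  and every new cell depends on the control and boundedly many cells, with a bound `locW`
  depending only on the program (`cellLocal_pStep`), uniformly in `S`.
* **Bisimulation** (`abs_stepTotal`, `abs_iterate_stepTotal`): on good configurations
  (`TM2Sim.Good`: only effective symbols) of height `≤ S - D`, `D = TM2Sim.depth tm`, the
  abstraction `absCfg : Cfg → PCfg S` commutes with `TM2Sim.stepTotal`; since heights grow by at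
  most `D` per step, `T` steps from an input of length `n` are simulated exactly in capacity
  `S ≥ n + D · T` (`pStep_iterate_pInit`).
* **Bits**: one-hot coding of control and cells (`enc`/`dec`) turns cell-locality into
  bit-locality (`CellLocal.isLocal_bits`), whence by `IsLocal.cktSize` (`LocalMaps.lean`) every
  layer costs `(a + S·b) · univBound w` gates; `T` layers, an input layer and a read-out layer
  give `FinTM2Sim.cktSize_sim`: size `≤ c · (S + 1) · (T + 1)` for the constant
  `c = simConst tm`; the packaged export is `FinTM2.exists_cktSize_sim` (constants `c`, `D`
  existential).

Sources: S. Arora, B. Barak, *Computational Complexity: A Modern Approach* (2009), Thm. 6.6 and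
proof of Thm. 2.10 (snapshots, tableau); M. Sipser, *Introduction to the Theory of Computation*,
3rd ed. (2012), Thm. 9.30, p. 338 ("If `A ∈ TIME(t(n))`, then `A` has circuit complexity `O(t²(n))`",
tableau proof pp. 338–341).

Mathlib provides the machine model (`Turing.FinTM2`, `Turing.TM2.stepAux`, `Turing.initList`,
`Turing.haltList`, `Turing.TM2OutputsInTime`) but no circuits and no simulation results; all
new declarations are in `namespace Literature.CplxCore` (generic block coding) and
`namespace Literature.CplxCore.FinTM2Sim` (the padded simulation), parametrised by `tm : Turing.FinTM2`.
-/

namespace Literature.Computability.Complexity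

open Finset

/-! ### One-hot block coding of `A × (Fin S → C)` and cell-locality -/

section Blocks

variable {A C : Type*} [Finite A] [Finite C] [Inhabited A] [Inhabited C]

/-- Bit positions of the one-hot code of a block configuration `A × (Fin S → C)`: `card A` bits
for the control and `card C` bits for each of the `S` cells (Arora–Barak 2009, proof of
Thm. 6.6, "encode each snapshot by a constant-size binary string"). [cite: AroraBarakCC2009, Thm. 6.6 (proof)] -/
abbrev BitIdx (A C : Type*) [Finite A] [Finite C] (S : ℕ) : Type :=
  Fin (Nat.card A) ⊕ (Fin S × Fin (Nat.card C))

/-- One-hot encoding of a block configuration (Arora–Barak 2009, proof of Thm. 6.6). [cite: AroraBarakCC2009, Thm. 6.6 (proof)] -/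
noncomputable def enc {S : ℕ} (c : A × (Fin S → C)) : BitIdx A C S → Bool :=
  Sum.elim (fun α => decide (Finite.equivFin A c.1 = α))
    (fun p => decide (Finite.equivFin C (c.2 p.1) = p.2))

/-- Decoding one one-hot block: the element whose bit is set (default if none). [folklore] -/
noncomputable def decBlock (X : Type*) [Finite X] [Inhabited X] (y : Fin (Nat.card X) → Bool) :
    X :=
  by classical exact if h : ∃ a : X, y (Finite.equivFin X a) = true then h.choose else default

/-- Decoding a bit vector to a block configuration, blockwise (left inverse of `enc`). [folklore] -/
noncomputable def dec {S : ℕ} (y : BitIdx A C S → Bool) : A × (Fin S → C) :=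
  (decBlock A fun α => y (.inl α), fun i => decBlock C fun β => y (.inr (i, β)))

omit [Inhabited C] in
/-- Decoding the one-hot code of `a` gives back `a`. [folklore] -/
theorem decBlock_enc (a : A) : decBlock A (fun α => decide (Finite.equivFin A a = α)) = a := by
  classical
  unfold decBlock
  have h : ∃ a' : A, decide (Finite.equivFin A a = Finite.equivFin A a') = true :=
    ⟨a, by simp⟩
  rw [dif_pos h]
  exact ((Finite.equivFin A).injective (of_decide_eq_true h.choose_spec)).symm

/-- `dec ∘ enc = id`. [folklore] -/
@[simp] theorem dec_enc {S : ℕ} (c : A × (Fin S → C)) : dec (enc c) = c := by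
  obtain ⟨a, cs⟩ := c
  simp only [dec, enc, Sum.elim_inl, Sum.elim_inr, Prod.mk.injEq]
  exact ⟨decBlock_enc a, funext fun i => decBlock_enc (cs i)⟩

omit [Finite A] [Finite C] [Inhabited A] [Inhabited C] in
/-- `CellLocal w F`: the block map `F` computes its new control from the control and at most
`w` cells, and each new cell from the control and at most `w` cells (Arora–Barak 2009, proof of
Thm. 6.6: a snapshot is determined by boundedly many earlier snapshots; Sipser 2012, proof of
Thm. 9.30: each tableau cell is determined by the three cells above it). [cite: AroraBarakCC2009, Thm. 6.6 (proof)] -/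
def CellLocal {S : ℕ} (w : ℕ) (F : A × (Fin S → C) → A × (Fin S → C)) : Prop :=
  (∃ s : Finset (Fin S), s.card ≤ w ∧ ∀ c c' : A × (Fin S → C), c.1 = c'.1 →
      (∀ i ∈ s, c.2 i = c'.2 i) → (F c).1 = (F c').1) ∧
  ∀ j : Fin S, ∃ s : Finset (Fin S), s.card ≤ w ∧ ∀ c c' : A × (Fin S → C), c.1 = c'.1 →
      (∀ i ∈ s, c.2 i = c'.2 i) → (F c).2 j = (F c').2 j

namespace CellLocal

omit [Finite A] [Finite C] [Inhabited A] [Inhabited C]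

variable {S : ℕ}

/-- Cell-locality is monotone in the width. [folklore] -/
theorem mono {w w' : ℕ} {F : A × (Fin S → C) → A × (Fin S → C)} (h : CellLocal w F)
    (hw : w ≤ w') : CellLocal w' F :=
  ⟨by obtain ⟨s, hs, h1⟩ := h.1; exact ⟨s, hs.trans hw, h1⟩,
    fun j => by obtain ⟨s, hs, h2⟩ := h.2 j; exact ⟨s, hs.trans hw, h2⟩⟩

/-- Cell-locality only depends on the map extensionally. [folklore] -/
theorem congr {w : ℕ} {F G : A × (Fin S → C) → A × (Fin S → C)} (h : CellLocal w F)
    (hFG : ∀ c, F c = G c) : CellLocal w G := by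
  refine ⟨?_, fun j => ?_⟩
  · obtain ⟨s, hs, h1⟩ := h.1
    exact ⟨s, hs, fun c c' h h' => by rw [← hFG, ← hFG]; exact h1 c c' h h'⟩
  · obtain ⟨s, hs, h2⟩ := h.2 j
    exact ⟨s, hs, fun c c' h h' => by rw [← hFG, ← hFG]; exact h2 c c' h h'⟩

/-- The identity is `1`-local. [folklore] -/
theorem id : CellLocal 1 (fun c : A × (Fin S → C) => c) := by
  classical
  exact ⟨⟨∅, by simp, fun c c' h _ => h⟩,
    fun j => ⟨{j}, by simp, fun c c' _ h => h j (Finset.mem_singleton_self j)⟩⟩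

/-- A map given cellwise by "new control = `φ` (control, cells on `s₀`), new cell
`j` = `ψ j` (control, cells on `s j`)" with `|s₀|, |s j| ≤ w` is `w`-local. This is the form
in which all primitive stack operations are presented. [folklore] -/
theorem of_dep {w : ℕ} (F : A × (Fin S → C) → A × (Fin S → C)) (s₀ : Finset (Fin S))
    (s : Fin S → Finset (Fin S)) (h₀ : s₀.card ≤ w) (hs : ∀ j, (s j).card ≤ w)
    (hF₁ : ∀ c c' : A × (Fin S → C), c.1 = c'.1 → (∀ i ∈ s₀, c.2 i = c'.2 i) →
      (F c).1 = (F c').1)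
    (hF₂ : ∀ j (c c' : A × (Fin S → C)), c.1 = c'.1 → (∀ i ∈ s j, c.2 i = c'.2 i) →
      (F c).2 j = (F c').2 j) : CellLocal w F :=
  ⟨⟨s₀, h₀, hF₁⟩, fun j => ⟨s j, hs j, hF₂ j⟩⟩

/-- **Composition**: a `w'`-local map after a `w`-local map is `(w + w' * w)`-local. [folklore] -/
theorem comp {w w' : ℕ} {F G : A × (Fin S → C) → A × (Fin S → C)} (hF : CellLocal w F)
    (hG : CellLocal w' G) : CellLocal (w + w' * w) (fun c => G (F c)) := by
  classical
  obtain ⟨⟨s₀, hs₀, hF₁⟩, hF₂⟩ := hF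
  choose sF hsF hF₂ using hF₂
  have key : ∀ (t : Finset (Fin S)), t.card ≤ w' →
      (s₀ ∪ t.biUnion sF).card ≤ w + w' * w ∧
      ∀ c c' : A × (Fin S → C), c.1 = c'.1 →
        (∀ i ∈ s₀ ∪ t.biUnion sF, c.2 i = c'.2 i) →
        (F c).1 = (F c').1 ∧ ∀ i ∈ t, (F c).2 i = (F c').2 i := by
    intro t ht
    refine ⟨?_, fun c c' h1 h2 => ⟨hF₁ c c' h1 fun i hi => h2 i (mem_union_left _ hi),
      fun i hi => hF₂ i c c' h1 fun i' hi' => h2 i' (mem_union_right _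
        (Finset.mem_biUnion.2 ⟨i, hi, hi'⟩))⟩⟩
    calc (s₀ ∪ t.biUnion sF).card ≤ s₀.card + (t.biUnion sF).card := card_union_le _ _
      _ ≤ w + ∑ i ∈ t, (sF i).card := add_le_add hs₀ card_biUnion_le
      _ ≤ w + ∑ _i ∈ t, w := by gcongr with i; exact hsF i
      _ = w + t.card * w := by simp
      _ ≤ w + w' * w := by gcongr
  refine ⟨?_, fun j => ?_⟩
  · obtain ⟨t, ht, hG₁⟩ := hG.1
    obtain ⟨hc, hk⟩ := key t ht
    exact ⟨_, hc, fun c c' h1 h2 => by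
      obtain ⟨e1, e2⟩ := hk c c' h1 h2
      exact hG₁ _ _ e1 e2⟩
  · obtain ⟨t, ht, hG₂⟩ := hG.2 j
    obtain ⟨hc, hk⟩ := key t ht
    exact ⟨_, hc, fun c c' h1 h2 => by
      obtain ⟨e1, e2⟩ := hk c c' h1 h2
      exact hG₂ _ _ e1 e2⟩

/-- **Selection by the control**: choosing among finitely many `w`-local maps according to the
control is `(card O * w)`-local. Branching (`O = Bool`) and dispatch on the current label
(`O = Option Λ`) are the two uses. [folklore] -/
theorem select {O : Type*} [Fintype O] {w : ℕ} (sel : A → O)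
    (G : O → A × (Fin S → C) → A × (Fin S → C)) (h : ∀ o, CellLocal w (G o)) :
    CellLocal (Fintype.card O * w) (fun c => G (sel c.1) c) := by
  classical
  have hG₁ := fun o => (h o).1
  choose s₀ hs₀ hG₁ using hG₁
  have hG₂ := fun o => (h o).2
  choose s hs hG₂ using hG₂
  refine ⟨⟨univ.biUnion s₀, ?_, fun c c' h1 h2 => ?_⟩,
    fun j => ⟨univ.biUnion fun o => s o j, ?_, fun c c' h1 h2 => ?_⟩⟩
  · calc (univ.biUnion s₀).card ≤ ∑ o, (s₀ o).card := card_biUnion_le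
      _ ≤ ∑ _o : O, w := sum_le_sum fun o _ => hs₀ o
      _ = Fintype.card O * w := by simp
  · show (G (sel c.1) c).1 = (G (sel c'.1) c').1
    rw [← h1]
    exact hG₁ (sel c.1) c c' h1 fun i hi => h2 i (Finset.mem_biUnion.2 ⟨_, mem_univ _, hi⟩)
  · calc (univ.biUnion fun o => s o j).card ≤ ∑ o, (s o j).card := card_biUnion_le
      _ ≤ ∑ _o : O, w := sum_le_sum fun o _ => hs o j
      _ = Fintype.card O * w := by simp
  · show (G (sel c.1) c).2 j = (G (sel c'.1) c').2 j
    rw [← h1]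
    exact hG₂ (sel c.1) j c c' h1 fun i hi => h2 i (Finset.mem_biUnion.2 ⟨_, mem_univ _, hi⟩)

end CellLocal

omit [Inhabited A] [Inhabited C] in
/-- Agreement of two bit vectors on the control block gives equal decoded controls, and
agreement on the block of cell `i` gives equal decoded cells. [folklore] -/
theorem dec_congr {S : ℕ} [Inhabited A] [Inhabited C] (y y' : BitIdx A C S → Bool) :
    ((∀ α, y (.inl α) = y' (.inl α)) → (dec y : A × (Fin S → C)).1 = (dec y').1) ∧
    ∀ i, (∀ β, y (.inr (i, β)) = y' (.inr (i, β))) → (dec y : A × (Fin S → C)).2 i =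
      (dec y').2 i := by
  constructor
  · intro h
    simp only [dec]
    congr 1
    exact funext h
  · intro i h
    simp only [dec]
    congr 1
    exact funext h

/-- The bit positions of the control block together with the blocks of the cells in `s`: at
most `card A + |s| * card C` positions, and two bit vectors agreeing there decode to the same
control and the same cells on `s`. [folklore] -/
theorem exists_blockBits {S w : ℕ} (s : Finset (Fin S)) (hs : s.card ≤ w) :
    ∃ B : Finset (BitIdx A C S), B.card ≤ Nat.card A + w * Nat.card C ∧
      ∀ y y' : BitIdx A C S → Bool, (∀ p ∈ B, y p = y' p) →
        (dec y : A × (Fin S → C)).1 = (dec y').1 ∧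
          ∀ i ∈ s, (dec y : A × (Fin S → C)).2 i = (dec y').2 i := by
  classical
  refine ⟨(univ : Finset (Fin (Nat.card A))).map ⟨Sum.inl, Sum.inl_injective⟩ ∪
      (s ×ˢ (univ : Finset (Fin (Nat.card C)))).map ⟨Sum.inr, Sum.inr_injective⟩, ?_,
    fun y y' hy => ⟨(dec_congr y y').1 fun α => hy _ ?_,
      fun i hi => (dec_congr y y').2 i fun β => hy _ ?_⟩⟩
  · calc _ ≤ _ + _ := card_union_le _ _
      _ = Nat.card A + s.card * Nat.card C := by simp
      _ ≤ Nat.card A + w * Nat.card C := by gcongr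
  · exact mem_union_left _ (Finset.mem_map.2 ⟨α, mem_univ _, rfl⟩)
  · exact mem_union_right _ (Finset.mem_map.2 ⟨(i, β), by simp [hi], rfl⟩)

/-- **Cell-local maps are bit-local**: conjugating a `w`-cell-local block map by the one-hot code
gives a `(card A + w * card C)`-local Boolean map (Arora–Barak 2009, proof of Thm. 6.6). [cite: AroraBarakCC2009, Thm. 6.6 (proof)] -/
theorem CellLocal.isLocal_bits {S w : ℕ} {F : A × (Fin S → C) → A × (Fin S → C)}
    (h : CellLocal w F) :
    IsLocal (Nat.card A + w * Nat.card C)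
      (fun (y : BitIdx A C S → Bool) => enc (F (dec y))) := by
  rintro (α | ⟨j, β⟩)
  · obtain ⟨s, hs, h1⟩ := h.1
    obtain ⟨B, hB, hagree⟩ := exists_blockBits (A := A) (C := C) s hs
    refine ⟨B, hB, fun y y' hy => ?_⟩
    obtain ⟨e1, e2⟩ := hagree y y' hy
    simp only [enc, Sum.elim_inl]
    rw [h1 (dec y) (dec y') e1 e2]
  · obtain ⟨s, hs, h2⟩ := h.2 j
    obtain ⟨B, hB, hagree⟩ := exists_blockBits (A := A) (C := C) s hs
    refine ⟨B, hB, fun y y' hy => ?_⟩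
    obtain ⟨e1, e2⟩ := hagree y y' hy
    simp only [enc, Sum.elim_inr]
    rw [h2 (dec y) (dec y') e1 e2]

/-- A read-out of the control and of cell `0` is `(card A + card C)`-bit-local. [folklore] -/
theorem isLocal_readout {S : ℕ} (r : A → C → Bool) :
    IsLocal (Nat.card A + 1 * Nat.card C) (fun (y : BitIdx A C S → Bool) (_ : Unit) =>
      r (dec y : A × (Fin S → C)).1
        (if h : 0 < S then (dec y : A × (Fin S → C)).2 ⟨0, h⟩ else default)) := by
  classical
  intro _
  obtain ⟨B, hB, hagree⟩ := exists_blockBits (A := A) (C := C) (S := S)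
    (if h : 0 < S then {⟨0, h⟩} else ∅) (w := 1) (by split <;> simp)
  refine ⟨B, hB, fun y y' hy => ?_⟩
  obtain ⟨e1, e2⟩ := hagree y y' hy
  show r (dec y).1 _ = r (dec y').1 _
  rw [e1]
  congr 1
  split
  · next h => exact e2 _ (by simp [h])
  · rfl

omit [Inhabited A] [Inhabited C] in
/-- The one-hot code of capacity `S` has `card A + S * card C` bits. [folklore] -/
theorem card_bitIdx (S : ℕ) : Fintype.card (BitIdx A C S) = Nat.card A + S * Nat.card C := by
  simp only [BitIdx, Fintype.card_sum, Fintype.card_prod, Fintype.card_fin]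

end Blocks

/-! ### Machine-specific part -/

namespace FinTM2Sim

open Turing

variable (tm : FinTM2)

-- `Turing.FinTM2` bundles its finiteness hypotheses as structure fields; Mathlib registers only
-- `decidableEqK`/`inhabitedσ` as instances. The fields concern the machine's own types
-- (`tm.K`, `tm.Λ`, `tm.σ`, `tm.Γ tm.k₀`), so making them local instances overrides nothing.
attribute [local instance] Turing.FinTM2.kFin Turing.FinTM2.ΛFin Turing.FinTM2.σFin
  Turing.FinTM2.Γk₀Fin

/-! #### The finite alphabet of reachable symbols -/

/-- The finite type of symbols that can occur on stack `k`: the effective alphabet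
`TM2Sim.IsSym tm k` of `TM2Window.lean` (symbols pushable by some statement, and every symbol of
the input stack) as a subtype. [folklore] -/
def StackSym (k : tm.K) : Type := ↥{γ : tm.Γ k | TM2Sim.IsSym tm k γ}

/-- The reachable alphabet of each stack is finite (`TM2Sim.finite_isSym`). [folklore] -/
instance (k : tm.K) : Finite (StackSym tm k) := (TM2Sim.finite_isSym tm k).to_subtype

/-- Restriction of a symbol to the reachable alphabet (`none` for unreachable symbols, which
never occur in a computation started on an input word). [folklore] -/
noncomputable def toSym (k : tm.K) (γ : tm.Γ k) : Option (StackSym tm k) :=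
  by classical exact if h : TM2Sim.IsSym tm k γ then some ⟨γ, h⟩ else none

/-- On reachable symbols `toSym` is the inclusion into the reachable alphabet. [folklore] -/
theorem toSym_of_isSym {k : tm.K} {γ : tm.Γ k} (h : TM2Sim.IsSym tm k γ) :
    toSym tm k γ = some ⟨γ, h⟩ := by
  classical
  simp [toSym, h]

/-- Forgetting the reachability proof after `toSym` gives the symbol back. [folklore] -/
theorem toSym_val {k : tm.K} {γ : tm.Γ k} (h : TM2Sim.IsSym tm k γ) :
    (toSym tm k γ).map Subtype.val = some γ := by
  rw [toSym_of_isSym tm h]; rfl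

/-! #### Padded configurations -/

/-- The control of a configuration: current label (`none` = halted) and internal state. [folklore] -/
abbrev Ctrl : Type := Option tm.Λ × tm.σ

/-- A cell: for every stack, the (reachable) symbol at a given depth, or `none`. [folklore] -/
abbrev Cell : Type := ∀ k : tm.K, Option (StackSym tm k)

/-- The default control: halted, in the initial internal state. [folklore] -/
instance : Inhabited (Ctrl tm) := ⟨(none, tm.initialState)⟩

/-- Padded configurations of capacity `S`: control and `S` cells, cell `i` holding the symbols
at depth `i` below the top of each stack (Sipser 2012, proof of Thm. 9.30: a row of the
tableau). [cite: Sipser2012, Thm. 9.30 (proof)] -/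
abbrev PCfg (S : ℕ) : Type := Ctrl tm × (Fin S → Cell tm)

variable {tm} {S : ℕ}

/-- Push on stack `k` in the padded representation: shift the `k`-column down by one and write
the new symbol at depth `0` (the deepest cell falls off; it is `none` whenever the height
invariant holds). [folklore] -/
def pPush (k : tm.K) (o : Option (StackSym tm k)) (cs : Fin S → Cell tm) : Fin S → Cell tm :=
  fun i => Function.update (cs i) k
    (if h : (i : ℕ) = 0 then o else cs ⟨i - 1, by omega⟩ k)

/-- Pop stack `k` in the padded representation: shift the `k`-column up by one. [folklore] -/
def pPop (k : tm.K) (cs : Fin S → Cell tm) : Fin S → Cell tm :=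
  fun i => Function.update (cs i) k
    (if h : (i : ℕ) + 1 < S then cs ⟨i + 1, h⟩ k else none)

/-- The top symbol of stack `k` in the padded representation. [folklore] -/
def pTop (k : tm.K) (cs : Fin S → Cell tm) : Option (tm.Γ k) :=
  if h : 0 < S then (cs ⟨0, h⟩ k).map Subtype.val else none

variable (S) in
/-- The padded semantics of a statement, by the same recursion as `Turing.TM2.stepAux`
(Sipser 2012, proof of Thm. 9.30; Arora–Barak 2009, proof of Thm. 6.6). [cite: AroraBarakCC2009, Thm. 6.6 (proof)] -/
noncomputable def pStepAux :
    TM2.Stmt tm.Γ tm.Λ tm.σ → tm.σ → (Fin S → Cell tm) → PCfg tm S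
  | TM2.Stmt.push k f q, v, cs => pStepAux q v (pPush k (toSym tm k (f v)) cs)
  | TM2.Stmt.peek k f q, v, cs => pStepAux q (f v (pTop k cs)) cs
  | TM2.Stmt.pop k f q, v, cs => pStepAux q (f v (pTop k cs)) (pPop k cs)
  | TM2.Stmt.load a q, v, cs => pStepAux q (a v) cs
  | TM2.Stmt.branch p q₁ q₂, v, cs => cond (p v) (pStepAux q₁ v cs) (pStepAux q₂ v cs)
  | TM2.Stmt.goto f, v, cs => ((some (f v), v), cs)
  | TM2.Stmt.halt, v, cs => ((none, v), cs)

variable (S) in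
/-- The padded semantics of a statement as an endo-map of padded configurations (the current
label is ignored). [folklore] -/
noncomputable def pSem (q : TM2.Stmt tm.Γ tm.Λ tm.σ) (c : PCfg tm S) : PCfg tm S :=
  pStepAux S q c.1.2 c.2

variable (S) in
/-- Dispatch table of the padded step: identity when halted, else the padded semantics of the
current label's statement. [folklore] -/
noncomputable def pDispatch : Option tm.Λ → PCfg tm S → PCfg tm S
  | none => fun c => c
  | some l => pSem S (tm.m l)

variable (tm S) in
/-- **The padded step**: one step of the machine on padded configurations of capacity `S`
(identity on halted configurations) (Sipser 2012, proof of Thm. 9.30; Arora–Barak 2009, proof of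
Thm. 6.6). [cite: AroraBarakCC2009, Thm. 6.6 (proof)] -/
noncomputable def pStep (c : PCfg tm S) : PCfg tm S :=
  pDispatch S c.1.1 c

/-! #### Cell-locality of the padded step -/

/-- The locality width of the padded semantics of a statement (a crude but `S`-independent
bound). [folklore] -/
def locW : TM2.Stmt tm.Γ tm.Λ tm.σ → ℕ
  | TM2.Stmt.push _ _ q => 2 + locW q * 2
  | TM2.Stmt.peek _ _ q => 1 + locW q * 1
  | TM2.Stmt.pop _ _ q => 1 + 2 * 1 + locW q * (1 + 2 * 1)
  | TM2.Stmt.load _ q => 1 + locW q * 1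
  | TM2.Stmt.branch _ q₁ q₂ => 2 * (locW q₁ + locW q₂)
  | TM2.Stmt.goto _ => 1
  | TM2.Stmt.halt => 1

/-- The push map `c ↦ (c.ctrl, pPush k (g c.ctrl) c.cells)` is `2`-local. [folklore] -/
theorem cellLocal_push (k : tm.K) (g : Ctrl tm → Option (StackSym tm k)) :
    CellLocal 2 (fun c : PCfg tm S => (c.1, pPush k (g c.1) c.2)) := by
  classical
  refine CellLocal.of_dep _ ∅ (fun j => {j, ⟨(j : ℕ) - 1, by omega⟩}) (by simp)
    (fun j => card_le_two) (fun c c' h _ => h) fun j c c' h1 h2 => ?_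
  simp only [pPush, h1, h2 j (by simp)]
  congr 1
  split
  · rfl
  · exact congrFun (h2 _ (by simp)) k

/-- The pop map `c ↦ (c.ctrl, pPop k c.cells)` is `2`-local. [folklore] -/
theorem cellLocal_pop (k : tm.K) :
    CellLocal 2 (fun c : PCfg tm S => (c.1, pPop k c.2)) := by
  classical
  refine CellLocal.of_dep _ ∅
    (fun j => if h : (j : ℕ) + 1 < S then {j, ⟨(j : ℕ) + 1, h⟩} else {j}) (by simp) (fun j => by split <;> simp [card_le_two]) (fun c c' h _ => h)
    fun j c c' h1 h2 => ?_
  simp only [pPop]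
  by_cases h : (j : ℕ) + 1 < S
  · simp only [h, ↓reduceDIte] at h2 ⊢
    rw [h2 j (by simp), congrFun (h2 ⟨(j : ℕ) + 1, h⟩ (by simp)) k]
  · simp only [h, ↓reduceDIte] at h2 ⊢
    rw [h2 j (by simp)]

/-- A control update reading the control and the top cell, `c ↦ (φ c.ctrl (cell 0), c.cells)`,
is `1`-local. [folklore] -/
theorem cellLocal_ctrl (φ : Ctrl tm → Option (Cell tm) → Ctrl tm) :
    CellLocal 1 (fun c : PCfg tm S =>
      (φ c.1 (if h : 0 < S then some (c.2 ⟨0, h⟩) else none), c.2)) := by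
  classical
  refine CellLocal.of_dep _ (if h : 0 < S then {⟨0, h⟩} else ∅) (fun j => {j})
    (by split <;> simp) (fun j => by simp) (fun c c' h1 h2 => ?_) fun j c c' _ h2 => h2 j (by simp)
  dsimp only
  rw [h1]
  congr 1
  split
  · next h => simp only [h, ↓reduceDIte] at h2; rw [h2 _ (mem_singleton_self _)]
  · rfl

/-- `pTop` in terms of the optional cell `0` (the form produced by `cellLocal_ctrl`). [folklore] -/
theorem pTop_eq (k : tm.K) (cs : Fin S → Cell tm) :
    pTop k cs = ((if h : 0 < S then some (cs ⟨0, h⟩) else none).bind fun cell =>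
      (cell k).map Subtype.val) := by
  unfold pTop; split <;> rfl

/-- **Cell-locality of statements**: the padded semantics of `q` is `locW q`-local, uniformly in
the capacity `S` (Arora–Barak 2009, proof of Thm. 6.6). [cite: AroraBarakCC2009, Thm. 6.6 (proof)] -/
theorem cellLocal_pSem : ∀ q : TM2.Stmt tm.Γ tm.Λ tm.σ, CellLocal (locW q) (pSem S q)
  | TM2.Stmt.push k f q => by
    have := (cellLocal_push (S := S) k fun a => toSym tm k (f a.2)).comp (cellLocal_pSem q)
    exact this.congr fun c => rfl
  | TM2.Stmt.peek k f q => by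
    have := (cellLocal_ctrl (S := S) fun a o =>
      (a.1, f a.2 (o.bind fun cell => (cell k).map Subtype.val))).comp (cellLocal_pSem q)
    refine this.congr fun c => ?_
    simp only [pSem, pStepAux, pTop_eq]
  | TM2.Stmt.pop k f q => by
    have h1 := (cellLocal_ctrl (S := S) fun a o =>
      (a.1, f a.2 (o.bind fun cell => (cell k).map Subtype.val))).comp (cellLocal_pop (S := S) k)
    have := h1.comp (cellLocal_pSem q)
    refine this.congr fun c => ?_
    simp only [pSem, pStepAux, pTop_eq]
  | TM2.Stmt.load a q => by
    have := (cellLocal_ctrl (S := S) fun c _ => (c.1, a c.2)).comp (cellLocal_pSem q)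
    exact this.congr fun c => rfl
  | TM2.Stmt.branch p q₁ q₂ => by
    have h := CellLocal.select (S := S) (w := locW q₁ + locW q₂) (fun a : Ctrl tm => p a.2)
      (fun b => cond b (pSem S q₁) (pSem S q₂)) fun b => by
        cases b
        · exact (cellLocal_pSem q₂).mono (Nat.le_add_left _ _)
        · exact (cellLocal_pSem q₁).mono (Nat.le_add_right _ _)
    refine (h.mono (by simp [locW])).congr fun c => ?_
    simp only [pSem, pStepAux]
    cases p c.1.2 <;> rfl
  | TM2.Stmt.goto f =>
    (cellLocal_ctrl (S := S) fun c _ => (some (f c.2), c.2)).congr fun c => rfl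
  | TM2.Stmt.halt =>
    (cellLocal_ctrl (S := S) fun c _ => (none, c.2)).congr fun c => rfl

variable (tm) in
/-- The locality width of one padded step of `tm` (independent of the capacity). [folklore] -/
noncomputable def stepW : ℕ :=
  Fintype.card (Option tm.Λ) * (1 + univ.sup fun l => locW (tm.m l))

/-- **Cell-locality of the padded step**, uniformly in the capacity `S` (Arora–Barak 2009,
proof of Thm. 6.6; Sipser 2012, proof of Thm. 9.30). [cite: AroraBarakCC2009, Thm. 6.6 (proof)] -/
theorem cellLocal_pStep : CellLocal (stepW tm) (pStep tm S) := by
  refine (CellLocal.select (S := S) (fun a : Ctrl tm => a.1) (pDispatch S) fun o => ?_).congr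
    fun c => rfl
  cases o with
  | none => exact CellLocal.id.mono (by omega)
  | some l =>
    exact (cellLocal_pSem (tm.m l)).mono
      (le_add_left (Finset.le_sup (f := fun l => locW (tm.m l)) (mem_univ l)))

/-! #### Abstraction of machine configurations and the bisimulation -/

variable (S) in
/-- The cells of the padded representation of a family of stacks (top of stack at depth `0`;
depths `≥ S` are cut off). [folklore] -/
noncomputable def absCells (stk : ∀ k, List (tm.Γ k)) : Fin S → Cell tm :=
  fun i k => ((stk k)[(i : ℕ)]?).bind (toSym tm k)

variable (S) in
/-- The abstraction of a machine configuration to a padded configuration of capacity `S`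
(Sipser 2012, proof of Thm. 9.30: the row of the tableau). [cite: Sipser2012, Thm. 9.30 (proof)] -/
noncomputable def absCfg (c : tm.Cfg) : PCfg tm S :=
  ((c.l, c.var), absCells S c.stk)

/-- Pushing commutes with abstraction. [folklore] -/
theorem absCells_push (stk : ∀ k, List (tm.Γ k)) (k : tm.K) (γ : tm.Γ k) :
    absCells S (Function.update stk k (γ :: stk k)) =
      pPush k (toSym tm k γ) (absCells S stk) := by
  funext i k'
  simp only [absCells, pPush]
  by_cases hk : k' = k
  · subst hk
    simp only [Function.update_self]
    split
    · next h => simp [h]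
    · next h =>
      obtain ⟨j, hj⟩ : ∃ j : ℕ, (i : ℕ) = j + 1 := ⟨i - 1, by omega⟩
      simp [hj]
  · simp [Function.update_of_ne hk, absCells]

/-- Popping commutes with abstraction, provided the stack fits into the capacity. [folklore] -/
theorem absCells_pop (stk : ∀ k, List (tm.Γ k)) (k : tm.K) (hlen : (stk k).length ≤ S) :
    absCells S (Function.update stk k (stk k).tail) = pPop k (absCells S stk) := by
  funext i k'
  simp only [absCells, pPop]
  by_cases hk : k' = k
  · subst hk
    simp only [Function.update_self, List.getElem?_tail]
    split
    · rfl
    · next h =>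
      rw [List.getElem?_eq_none (by omega)]
      rfl
  · simp [Function.update_of_ne hk, absCells]

/-- The top of a stack of effective symbols is read off correctly from the padded
representation. [folklore] -/
theorem pTop_absCells (stk : ∀ k, List (tm.Γ k)) (hV : ∀ k, ∀ γ ∈ stk k, TM2Sim.IsSym tm k γ)
    (k : tm.K) (hlen : (stk k).length ≤ S) : pTop k (absCells S stk) = (stk k).head? := by
  unfold pTop
  split
  · next h =>
    simp only [absCells]
    cases hs : stk k with
    | nil => rfl
    | cons γ rest =>
      simp only [List.getElem?_cons_zero, Option.bind_some, List.head?_cons]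
      exact toSym_val tm (hV k γ (by simp [hs]))
  · next h =>
    have : stk k = [] := List.eq_nil_of_length_eq_zero (by omega)
    simp [this]

/-- Pushing an effective symbol keeps all stack symbols effective. [folklore] -/
theorem isSym_update_cons {stk : ∀ k, List (tm.Γ k)} (hV : ∀ k, ∀ γ ∈ stk k, TM2Sim.IsSym tm k γ)
    {k : tm.K} {γ : tm.Γ k} (hγ : TM2Sim.IsSym tm k γ) :
    ∀ k', ∀ γ' ∈ Function.update stk k (γ :: stk k) k', TM2Sim.IsSym tm k' γ' := by
  intro k' γ' h
  by_cases hk : k' = k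
  · subst hk
    simp only [Function.update_self, List.mem_cons] at h
    rcases h with rfl | h
    exacts [hγ, hV _ _ h]
  · rw [Function.update_of_ne hk] at h
    exact hV _ _ h

/-- Popping keeps all stack symbols effective. [folklore] -/
theorem isSym_update_tail {stk : ∀ k, List (tm.Γ k)} (hV : ∀ k, ∀ γ ∈ stk k, TM2Sim.IsSym tm k γ)
    (k : tm.K) : ∀ k', ∀ γ' ∈ Function.update stk k (stk k).tail k', TM2Sim.IsSym tm k' γ' := by
  intro k' γ' h
  by_cases hk : k' = k
  · subst hk
    rw [Function.update_self] at h
    exact hV _ _ (List.mem_of_mem_tail h)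
  · rw [Function.update_of_ne hk] at h
    exact hV _ _ h

/-- **One statement**: on stacks of effective symbols with head-room `TM2Sim.opDepth q`,
executing the statement `q` commutes with abstraction (Sipser 2012, proof of Thm. 9.30;
Arora–Barak 2009, proof of Thm. 6.6). [cite: AroraBarakCC2009, Thm. 6.6 (proof)] -/
theorem abs_stepAux :
    ∀ (q : TM2.Stmt tm.Γ tm.Λ tm.σ) (v : tm.σ) (stk : ∀ k, List (tm.Γ k)),
      (∀ k γ, TM2Sim.PushesSym q k γ → TM2Sim.IsSym tm k γ) →
      (∀ k, ∀ γ ∈ stk k, TM2Sim.IsSym tm k γ) → (∀ k, (stk k).length + TM2Sim.opDepth q ≤ S) →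
      absCfg S (TM2.stepAux q v stk) = pStepAux S q v (absCells S stk)
  | TM2.Stmt.push k f q, v, stk, hq, hV, hlen => by
    have hγ : TM2Sim.IsSym tm k (f v) := hq k _ (TM2Sim.PushesSym.push_here f q v)
    simp only [TM2.stepAux, pStepAux]
    rw [abs_stepAux q v _ (fun k' γ h => hq k' γ (TM2Sim.PushesSym.push_below f q h))
      (isSym_update_cons hV hγ), absCells_push]
    intro k'
    have := hlen k'
    by_cases hk : k' = k
    · subst hk
      simp only [Function.update_self, List.length_cons, TM2Sim.opDepth] at this ⊢
      omega
    · rw [Function.update_of_ne hk]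
      simp only [TM2Sim.opDepth] at this
      omega
  | TM2.Stmt.peek k f q, v, stk, hq, hV, hlen => by
    simp only [TM2.stepAux, pStepAux]
    rw [pTop_absCells stk hV k (by have := hlen k; omega),
      abs_stepAux q _ stk (fun k' γ h => hq k' γ (TM2Sim.PushesSym.peek f q h)) hV fun k' => by
        have := hlen k'; simp only [TM2Sim.opDepth] at this; omega]
  | TM2.Stmt.pop k f q, v, stk, hq, hV, hlen => by
    simp only [TM2.stepAux, pStepAux]
    rw [pTop_absCells stk hV k (by have := hlen k; omega),
      abs_stepAux q _ _ (fun k' γ h => hq k' γ (TM2Sim.PushesSym.pop f q h))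
        (isSym_update_tail hV k), absCells_pop stk k (by have := hlen k; omega)]
    intro k'
    have := hlen k'
    by_cases hk : k' = k
    · subst hk
      simp only [Function.update_self, List.length_tail, TM2Sim.opDepth] at this ⊢
      omega
    · rw [Function.update_of_ne hk]
      simp only [TM2Sim.opDepth] at this
      omega
  | TM2.Stmt.load a q, v, stk, hq, hV, hlen => by
    simp only [TM2.stepAux, pStepAux]
    exact abs_stepAux q _ stk (fun k' γ h => hq k' γ (TM2Sim.PushesSym.load a q h)) hV
      fun k' => by have := hlen k'; simp only [TM2Sim.opDepth] at this; omega
  | TM2.Stmt.branch p q₁ q₂, v, stk, hq, hV, hlen => by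
    simp only [TM2.stepAux, pStepAux]
    rw [← abs_stepAux q₁ v stk (fun k' γ h => hq k' γ (TM2Sim.PushesSym.branch_left p q₁ q₂ h))
        hV fun k => le_trans (by simp only [TM2Sim.opDepth]; omega) (hlen k),
      ← abs_stepAux q₂ v stk (fun k' γ h => hq k' γ (TM2Sim.PushesSym.branch_right p q₁ q₂ h))
        hV fun k => le_trans (by simp only [TM2Sim.opDepth]; omega) (hlen k)]
    cases p v <;> rfl
  | TM2.Stmt.goto f, v, stk, _, _, _ => rfl
  | TM2.Stmt.halt, v, stk, _, _, _ => rfl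

/-- **One step**: on good configurations (`TM2Sim.Good`) with head-room `TM2Sim.depth tm`, the
total machine step `TM2Sim.stepTotal` commutes with abstraction (Sipser 2012, proof of
Thm. 9.30; Arora–Barak 2009, proof of Thm. 6.6). [cite: AroraBarakCC2009, Thm. 6.6 (proof)] -/
theorem abs_stepTotal (c : tm.Cfg) (hV : TM2Sim.Good tm c)
    (hlen : ∀ k, (c.stk k).length + TM2Sim.depth tm ≤ S) :
    absCfg S (TM2Sim.stepTotal tm c) = pStep tm S (absCfg S c) := by
  obtain ⟨_ | l, v, stk⟩ := c
  · rfl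
  · rw [TM2Sim.stepTotal_of_some tm rfl]
    exact abs_stepAux (tm.m l) v stk (fun k γ h => Or.inl ⟨l, h⟩) hV fun k =>
      le_trans (Nat.add_le_add_left (TM2Sim.opDepth_le_depth tm l) _) (hlen k)

/-- **`t` steps**: for capacity `S ≥ n + D · T` (`D = TM2Sim.depth tm`), abstraction commutes with
the first `T` total steps from a good configuration of height `≤ n` (heights grow by at most `D`
per step, `TM2Sim.length_iterate_stepTotal_le`; goodness is invariant, `TM2Sim.Good.iterate`)
(Sipser 2012, proof of Thm. 9.30). [cite: Sipser2012, Thm. 9.30 (proof)] -/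
theorem abs_iterate_stepTotal (c : tm.Cfg) (hV : TM2Sim.Good tm c) {n T : ℕ}
    (hn : ∀ k, (c.stk k).length ≤ n) (hS : n + TM2Sim.depth tm * T ≤ S) :
    ∀ t ≤ T, absCfg S ((TM2Sim.stepTotal tm)^[t] c) = (pStep tm S)^[t] (absCfg S c)
  | 0, _ => rfl
  | t + 1, ht => by
    rw [Function.iterate_succ_apply', Function.iterate_succ_apply',
      ← abs_iterate_stepTotal c hV hn hS t (by omega)]
    refine abs_stepTotal _ (TM2Sim.Good.iterate tm hV t) fun k =>
      (Nat.add_le_add_right (TM2Sim.length_iterate_stepTotal_le tm c k t) _).trans (le_trans ?_ hS)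
    have h1 := hn k
    have h2 : TM2Sim.depth tm * t + TM2Sim.depth tm ≤ TM2Sim.depth tm * T := by
      rw [← Nat.mul_succ]; exact Nat.mul_le_mul_left _ ht
    omega

/-! #### Halting computations, initial and halting configurations -/

/-- A halting computation within time `T`, iterated exactly `T` times with the total step function,
sits in its halting configuration (from `TM2Sim.iterate_stepTotal_of_bind` and
`TM2Sim.iterate_stepTotal_of_none`; cf. `TM2Sim.iterate_stepTotal_of_outputsWithin` for bundled
`TM2ComputableAux` machines). [folklore] -/
theorem stepTotal_iterate_eq_of_evals {c c' : tm.Cfg} {T : ℕ}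
    (h : StateTransition.EvalsToInTime tm.step c (some c') T) (hc' : c'.l = none) :
    (TM2Sim.stepTotal tm)^[T] c = c' := by
  have h1 : (TM2Sim.stepTotal tm)^[h.steps] c = c' :=
    TM2Sim.iterate_stepTotal_of_bind tm h.evals_in_steps
  rw [← Nat.sub_add_cancel h.steps_le_m, Function.iterate_add_apply, h1,
    TM2Sim.iterate_stepTotal_of_none tm hc']

variable (S) in
/-- The padded initial configuration on an input of length `n` given symbolwise. [folklore] -/
noncomputable def pInit (n : ℕ) (g : Fin n → tm.Γ tm.k₀) : PCfg tm S :=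
  ((some tm.main, tm.initialState), fun i =>
    Function.update (fun k => (none : Option (StackSym tm k))) tm.k₀
      (if h : (i : ℕ) < n then toSym tm tm.k₀ (g ⟨i, h⟩) else none))

/-- The abstraction of the initial configuration (Mathlib `Turing.initList`, in the form
`TM2Comp.initList_eq`: the input on the input stack, all other stacks empty) is the padded
initial configuration. [folklore] -/
theorem abs_initList {n : ℕ} (g : Fin n → tm.Γ tm.k₀) :
    absCfg S (initList tm (List.ofFn g)) = pInit S n g := by
  rw [TM2Comp.initList_eq]
  refine Prod.ext rfl (funext fun i => funext fun k => ?_)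
  simp only [absCfg, absCells, pInit]
  by_cases hk : k = tm.k₀
  · subst hk
    rw [Function.update_self, Function.update_self, List.getElem?_ofFn]
    split <;> rfl
  · rw [Function.update_of_ne hk, Function.update_of_ne hk]
    rfl

/-- The stacks of the initial configuration are no longer than the input. [folklore] -/
theorem length_initList_le (s : List (tm.Γ tm.k₀)) (k : tm.K) :
    ((initList tm s).stk k).length ≤ s.length := by
  rw [TM2Comp.initList_eq]
  exact TM2Comp.length_update_bot_le tm.k₀ k s

/-- **Correctness of the padded simulation**: if the machine, started on the input `g`, halts with
output `out` within `T` steps, then `T` padded steps of capacity `S ≥ n + D · T` from the padded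
initial configuration reach the abstraction of the halting configuration, and the output
consists of effective symbols (Arora–Barak 2009, proof of Thm. 6.6; Sipser 2012, proof of
Thm. 9.30). [cite: AroraBarakCC2009, Thm. 6.6 (proof)] -/
theorem pStep_iterate_pInit {n T : ℕ} (g : Fin n → tm.Γ tm.k₀) (out : List (tm.Γ tm.k₁))
    (h : Nonempty (TM2OutputsInTime tm (List.ofFn g) (some out) T))
    (hS : n + TM2Sim.depth tm * T ≤ S) :
    (pStep tm S)^[T] (pInit S n g) = absCfg S (haltList tm out) ∧
      ∀ γ ∈ out, TM2Sim.IsSym tm tm.k₁ γ := by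
  obtain ⟨h⟩ := h
  have hT : (TM2Sim.stepTotal tm)^[T] (initList tm (List.ofFn g)) = haltList tm out :=
    stepTotal_iterate_eq_of_evals h rfl
  have hn : ∀ k, ((initList tm (List.ofFn g)).stk k).length ≤ n := fun k =>
    (length_initList_le _ k).trans (by simp)
  refine ⟨?_, fun γ hγ => ?_⟩
  · rw [← abs_initList, ← abs_iterate_stepTotal _ (TM2Sim.good_initList tm _) hn hS T le_rfl, hT]
  · have := TM2Sim.Good.iterate tm (TM2Sim.good_initList tm (List.ofFn g)) T
    rw [hT, TM2Comp.haltList_eq] at this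
    exact this tm.k₁ γ (by simpa using hγ)

/-! #### The circuits -/

section Bits

variable (tm S)

/-- One padded step on one-hot codes (Arora–Barak 2009, proof of Thm. 6.6: one layer of the
circuit). [cite: AroraBarakCC2009, Thm. 6.6 (proof)] -/
noncomputable def stepBits :
    (BitIdx (Ctrl tm) (Cell tm) S → Bool) → BitIdx (Ctrl tm) (Cell tm) S → Bool :=
  fun y => enc (pStep tm S (dec y))

/-- The one-hot code of the padded initial configuration as a function of the input bits
(`g` translates input bits to input symbols). [folklore] -/
noncomputable def initBits (n : ℕ) (g : Bool → tm.Γ tm.k₀) (x : Fin n → Bool) :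
    BitIdx (Ctrl tm) (Cell tm) S → Bool :=
  enc (pInit S n fun i => g (x i))

/-- Reading out a Boolean from the control and the top cell of a one-hot code. [folklore] -/
noncomputable def readBits (r : Ctrl tm → Cell tm → Bool)
    (y : BitIdx (Ctrl tm) (Cell tm) S → Bool) (_ : Unit) : Bool :=
  r (dec y : PCfg tm S).1 (if h : 0 < S then (dec y : PCfg tm S).2 ⟨0, h⟩ else default)

variable {tm S}

/-- The bit-level step on a code word is the code word of the padded step. [folklore] -/
theorem stepBits_enc (c : PCfg tm S) : stepBits tm S (enc c) = enc (pStep tm S c) := by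
  simp [stepBits]

/-- Iterating the bit-level step on a code word gives the code word of the iterated padded step. [folklore] -/
theorem stepBits_iterate_enc (T : ℕ) (c : PCfg tm S) :
    (stepBits tm S)^[T] (enc c) = enc ((pStep tm S)^[T] c) :=
  (Function.Semiconj.iterate_right (f := enc) (ga := pStep tm S) (gb := stepBits tm S)
    (fun c => (stepBits_enc c).symm) T c).symm

/-- One layer costs `(a + S b) · univBound (a + stepW · b)` gates. [folklore] -/
theorem cktSize_stepBits : CktSize B2 (stepBits tm S)
    ((Nat.card (Ctrl tm) + S * Nat.card (Cell tm)) *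
      univBound (Nat.card (Ctrl tm) + stepW tm * Nat.card (Cell tm))) := by
  have := (cellLocal_pStep (tm := tm) (S := S)).isLocal_bits.cktSize
  rw [card_bitIdx] at this
  exact this.congr fun _ _ => rfl

/-- The input layer is `1`-local. [folklore] -/
theorem isLocal_initBits (n : ℕ) (g : Bool → tm.Γ tm.k₀) :
    IsLocal 1 (initBits tm S n g) := by
  classical
  rintro (α | ⟨i, β⟩)
  · exact ⟨∅, by simp, fun x y _ => rfl⟩
  · by_cases hi : (i : ℕ) < n
    · refine ⟨{⟨i, hi⟩}, by simp, fun x y hxy => ?_⟩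
      have := hxy ⟨i, hi⟩ (by simp)
      simp [initBits, enc, pInit, hi, this]
    · refine ⟨∅, by simp, fun x y _ => ?_⟩
      simp [initBits, enc, pInit, hi]

/-- The input layer costs `(a + S b) · univBound 1` gates. [folklore] -/
theorem cktSize_initBits (n : ℕ) (g : Bool → tm.Γ tm.k₀) : CktSize B2 (initBits tm S n g)
    ((Nat.card (Ctrl tm) + S * Nat.card (Cell tm)) * univBound 1) := by
  have := (isLocal_initBits (S := S) n g).cktSize
  rwa [card_bitIdx] at this

/-- The read-out layer costs `univBound (a + b)` gates. [folklore] -/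
theorem cktSize_readBits (r : Ctrl tm → Cell tm → Bool) : CktSize B2 (readBits tm S r)
    (univBound (Nat.card (Ctrl tm) + Nat.card (Cell tm))) := by
  have := (isLocal_readout (A := Ctrl tm) (C := Cell tm) (S := S) r).cktSize
  simp only [Fintype.card_unit, one_mul] at this
  exact this.congr fun _ _ => rfl

variable (tm) in
/-- The constant of the simulation: `3 (a + b + 1) (U₁ + U_step + U_read)`. [folklore] -/
noncomputable def simConst : ℕ :=
  3 * (Nat.card (Ctrl tm) + Nat.card (Cell tm) + 1) *
    (univBound 1 + univBound (Nat.card (Ctrl tm) + stepW tm * Nat.card (Cell tm)) +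
      univBound (Nat.card (Ctrl tm) + Nat.card (Cell tm)))

/-- **Size of the simulation**: input layer, `T` step layers and read-out together cost at most
`simConst · (S + 1) · (T + 1)` gates (Arora–Barak 2009, proof of Thm. 6.6: "an `O(T(n))`-sized
circuit" per layer count; Sipser 2012, Thm. 9.30: size `O(t²)`). [cite: AroraBarakCC2009, Thm. 6.6 (proof)] -/
theorem cktSize_sim (n T : ℕ) (g : Bool → tm.Γ tm.k₀) (r : Ctrl tm → Cell tm → Bool) :
    CktSize B2
      (fun (x : Fin n → Bool) => readBits tm S r ((stepBits tm S)^[T] (initBits tm S n g x)))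
      (simConst tm * (S + 1) * (T + 1)) := by
  have h := ((cktSize_initBits (S := S) n g).comp ((cktSize_stepBits (tm := tm) (S := S)).iterate
    T)).comp (cktSize_readBits (S := S) r)
  refine h.of_le ?_
  set a := Nat.card (Ctrl tm)
  set b := Nat.card (Cell tm)
  set U₁ := univBound 1
  set U₂ := univBound (a + stepW tm * b)
  set U₃ := univBound (a + b)
  have hc : a + S * b ≤ (a + b + 1) * (S + 1) := by nlinarith [Nat.zero_le a, Nat.zero_le b]
  have h1 : (a + S * b) * U₁ ≤ (a + b + 1) * (S + 1) * (T + 1) * (U₁ + U₂ + U₃) :=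
    calc (a + S * b) * U₁ ≤ (a + b + 1) * (S + 1) * U₁ := Nat.mul_le_mul_right _ hc
      _ ≤ (a + b + 1) * (S + 1) * (T + 1) * (U₁ + U₂ + U₃) :=
        Nat.mul_le_mul (Nat.le_mul_of_pos_right _ (Nat.succ_pos T)) (by omega)
  have h2 : T * ((a + S * b) * U₂) ≤ (a + b + 1) * (S + 1) * (T + 1) * (U₁ + U₂ + U₃) :=
    calc T * ((a + S * b) * U₂) ≤ (T + 1) * (((a + b + 1) * (S + 1)) * U₂) :=
        Nat.mul_le_mul (Nat.le_succ T) (Nat.mul_le_mul_right _ hc)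
      _ = (a + b + 1) * (S + 1) * (T + 1) * U₂ := by ring
      _ ≤ (a + b + 1) * (S + 1) * (T + 1) * (U₁ + U₂ + U₃) :=
        Nat.mul_le_mul_left _ (by omega)
  have h3 : U₃ ≤ (a + b + 1) * (S + 1) * (T + 1) * (U₁ + U₂ + U₃) :=
    calc U₃ = 1 * U₃ := (one_mul _).symm
      _ ≤ (a + b + 1) * (S + 1) * (T + 1) * (U₁ + U₂ + U₃) :=
        Nat.mul_le_mul (Nat.one_le_iff_ne_zero.2 (by positivity)) (by omega)
  calc (a + S * b) * U₁ + T * ((a + S * b) * U₂) + U₃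
      ≤ 3 * ((a + b + 1) * (S + 1) * (T + 1) * (U₁ + U₂ + U₃)) := by omega
    _ = simConst tm * (S + 1) * (T + 1) := by simp only [simConst]; ring

/-- **Semantics of the simulation**: the circuit reads out `r` on the padded configuration after
`T` padded steps. [folklore] -/
theorem sim_apply (n T : ℕ) (g : Bool → tm.Γ tm.k₀) (r : Ctrl tm → Cell tm → Bool)
    (x : Fin n → Bool) :
    readBits tm S r ((stepBits tm S)^[T] (initBits tm S n g x)) () =
      r ((pStep tm S)^[T] (pInit S n fun i => g (x i))).1
        (if h : 0 < S then ((pStep tm S)^[T] (pInit S n fun i => g (x i))).2 ⟨0, h⟩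
          else default) := by
  simp only [readBits, initBits, stepBits_iterate_enc, dec_enc]

end Bits

end FinTM2Sim

/-! ### Export: deciding machines have small circuits -/

open Turing FinTM2Sim in
/-- **Circuit simulation of a halting `FinTM2` computation** (the core of `P ⊆ P/poly`,
Arora–Barak 2009, Thm. 6.6; Sipser 2012, Thm. 9.30). For every machine `tm`, translation `g` of
input bits to input symbols and designated output symbol `γ₁`, there are constants `c, D` such
that for all `n, T` and every capacity `S > n + D · T` some Boolean function `F` of `n` bits has
`B₂`-circuits of size `≤ c · (S + 1) · (T + 1)` and, whenever the machine started on (the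
translation of) `x` halts within `T` steps with a nonempty output stack `o :: rest`, `F x` tells
whether the top output symbol `o` is `γ₁`. [cite: AroraBarakCC2009, Thm. 6.6 (proof)] -/
theorem FinTM2.exists_cktSize_sim (tm : FinTM2) (g : Bool → tm.Γ tm.k₀)
    (γ₁ : tm.Γ tm.k₁) :
    ∃ c D : ℕ, ∀ n T S : ℕ, n + D * T < S →
      ∃ F : (Fin n → Bool) → Unit → Bool, CktSize B2 F (c * (S + 1) * (T + 1)) ∧
        ∀ (x : Fin n → Bool) (o : tm.Γ tm.k₁) (rest : List (tm.Γ tm.k₁)),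
          Nonempty (TM2OutputsInTime tm (List.ofFn fun i => g (x i)) (some (o :: rest)) T) →
            (F x () = true ↔ o = γ₁) := by
  classical
  refine ⟨simConst tm, TM2Sim.depth tm, fun n T S hS => ⟨_, cktSize_sim (S := S) n T g
    (fun _ cell => decide (cell tm.k₁ = toSym tm tm.k₁ γ₁)), fun x o rest h => ?_⟩⟩
  have hS0 : 0 < S := by omega
  obtain ⟨hiter, hval⟩ :=
    pStep_iterate_pInit (S := S) (fun i => g (x i)) (o :: rest) h (by omega)
  have hhalt : (haltList tm (o :: rest)).stk tm.k₁ = o :: rest := by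
    simp [TM2Comp.haltList_eq]
  rw [sim_apply, hiter, dif_pos hS0]
  simp only [FinTM2Sim.absCfg, absCells, hhalt, List.getElem?_cons_zero,
    Option.bind_some, decide_eq_true_eq]
  have ho : TM2Sim.IsSym tm tm.k₁ o := hval o (by simp)
  rw [toSym_of_isSym tm ho]
  constructor
  · intro heq
    by_cases h₁ : TM2Sim.IsSym tm tm.k₁ γ₁
    · rw [toSym_of_isSym tm h₁, Option.some.injEq] at heq
      exact congrArg Subtype.val heq
    · simp [toSym, h₁] at heq
  · rintro rfl
    rw [toSym_of_isSym tm ho]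

end Literature.Computability.Complexity
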